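import Mathlib

/-!
# SoloInformedDepthSqueeze — the rank-one numerical criterion behind `R_D = O`
(solo-Langlands-informed s41, FINDING_R9 §2, LEMMA S)

Let `φ : R → O` be a map of commutative `O`-algebras and `y ∈ R` an element of the Jacobson
radical such that

* `O → R/(y)` is surjective (`hgen`);
* some `a : O` maps into `(y)` and divides `φ y` (`hdepth`: "the depth of the congruence is at
  least the index of the reducibility ideal");
* `φ y` is a non-zero-divisor of `O` (`hnzd`);
* `ker φ` is finitely generated (`hfg`).

Then `φ` is injective (`depthSqueeze_injective`), hence bijective (`depthSqueeze_bijective`,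
`depthSqueezeEquiv`).  Proof: for `z ∈ ker φ` write `z = o·1 + z₁ y`; applying `φ` gives
`o = -φ(y) φ(z₁)`; writing `φ(y)·1 = r y` and applying `φ` again gives `φ r = 1` (`φ y` is a
non-zero-divisor), so `z = y (z₁ - r φ(z₁)) ∈ y · ker φ`, and Nakayama
(`Submodule.eq_bot_of_le_smul_of_le_jacobson_bot`) gives `ker φ = 0`.

This is the `𝕋 = O`, one-generator case of the Berger–Klosin commutative-algebra criterion
[arXiv:1103.5100, Thm. 50 / Prop. 51].  In the cell model (FINDING_R9 §3): `R = R_D` is the flat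
deformation ring of the residual extension `ρ₀` of `χ̃ω` by `1`, `O = ℤ₇`, `φ = φ_g` is the point of
the congruent cusp form `g`, `y` generates the (principal) reducibility ideal, `a = 7^s` with
`#(R_D/I_re) = 7^s ≤ 7^e` (Berger–Klosin 2013 Thm. 35/Prop. 45 with the Selmer bound of
Berger–Klosin 2019 Prop. 25) and `7^e ∣ φ_g(y)` (the Eisenstein congruence has depth `e`); the lemma
gives `R_D = ℤ₇`, i.e. hypothesis (R) of FINDING_I, at all nine cyclic `p = 7` cells including the
split-7 conductors `f = 439, 571, 661`.
-/

namespace Summit.Langlands.Langlands.Theorems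

/-- **Rank-one depth squeeze.**  An `O`-algebra map `φ : R → O` is injective as soon as
`R/(y)` is a quotient of `O` for some `y` in the Jacobson radical, some `a : O` with `a·1 ∈ (y)`
divides `φ y`, `φ y` is a non-zero-divisor and `ker φ` is finitely generated. -/
theorem depthSqueeze_injective {O R : Type*} [CommRing O] [CommRing R] [Algebra O R]
    (φ : R →ₐ[O] O) (y : R) (hy : y ∈ (⊥ : Ideal R).jacobson)
    (hgen : ∀ r : R, ∃ o : O, r - algebraMap O R o ∈ Ideal.span {y})
    (hdepth : ∃ a : O, algebraMap O R a ∈ Ideal.span {y} ∧ a ∣ φ y)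
    (hnzd : φ y ∈ nonZeroDivisors O)
    (hfg : (RingHom.ker φ).FG) :
    Function.Injective φ := by
  have hcomm : ∀ o : O, φ (algebraMap O R o) = o := fun o => by simp
  -- Step 0: `φ(y)·1 = r * y` with `φ r = 1`.
  obtain ⟨a, ha, c, hc⟩ := hdepth
  have hφy : algebraMap O R (φ y) ∈ Ideal.span {y} := by
    rw [hc, map_mul]
    exact Ideal.mul_mem_right _ _ ha
  obtain ⟨r, hr⟩ := Ideal.mem_span_singleton'.mp hφy
  have hφr : φ r = 1 := by
    have h1 : φ r * φ y = φ y := by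
      rw [← map_mul, hr, hcomm]
    have h2 : (φ r - 1) * φ y = 0 := by
      rw [sub_mul, one_mul, h1, sub_self]
    exact sub_eq_zero.mp ((mul_right_mem_nonZeroDivisors_eq_zero_iff hnzd).mp h2)
  -- Step 1: `ker φ ≤ (y) • ker φ`.
  have hle : RingHom.ker φ ≤ Ideal.span {y} • RingHom.ker φ := by
    intro z hz
    have hz0 : φ z = 0 := RingHom.mem_ker.mp hz
    obtain ⟨o, ho⟩ := hgen z
    obtain ⟨z₁, hz₁⟩ := Ideal.mem_span_singleton'.mp ho
    -- applying `φ` to `z₁ y = z - o·1` gives `o = -(φ y) (φ z₁)`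
    have ho' : o = -(φ y * φ z₁) := by
      have h := congrArg φ hz₁
      rw [map_mul, map_sub, hz0, hcomm, zero_sub] at h
      linear_combination h
    -- hence `z = y w` with `w ∈ ker φ`
    have hwK : z₁ - r * algebraMap O R (φ z₁) ∈ RingHom.ker φ := by
      rw [RingHom.mem_ker, map_sub, map_mul, hφr, hcomm, one_mul, sub_self]
    have hzw : z = y * (z₁ - r * algebraMap O R (φ z₁)) := by
      have e1 : z = algebraMap O R o + z₁ * y := by
        rw [hz₁]; ring
      rw [e1, ho', map_neg, map_mul, ← hr]
      ring
    rw [hzw, ← smul_eq_mul]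
    exact Submodule.smul_mem_smul (Ideal.mem_span_singleton_self y) hwK
  -- Step 2: Nakayama.
  have hjac : Ideal.span {y} ≤ (⊥ : Ideal R).jacobson :=
    Ideal.span_le.mpr (Set.singleton_subset_iff.mpr hy)
  have hKbot : RingHom.ker φ = ⊥ :=
    Submodule.eq_bot_of_le_smul_of_le_jacobson_bot _ _ hfg hle hjac
  exact (RingHom.injective_iff_ker_eq_bot φ).mpr hKbot

/-- Under the hypotheses of `depthSqueeze_injective` the map `φ` is bijective (an `O`-algebra map
to `O` is always surjective). -/
theorem depthSqueeze_bijective {O R : Type*} [CommRing O] [CommRing R] [Algebra O R]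
    (φ : R →ₐ[O] O) (y : R) (hy : y ∈ (⊥ : Ideal R).jacobson)
    (hgen : ∀ r : R, ∃ o : O, r - algebraMap O R o ∈ Ideal.span {y})
    (hdepth : ∃ a : O, algebraMap O R a ∈ Ideal.span {y} ∧ a ∣ φ y)
    (hnzd : φ y ∈ nonZeroDivisors O)
    (hfg : (RingHom.ker φ).FG) :
    Function.Bijective φ :=
  ⟨depthSqueeze_injective φ y hy hgen hdepth hnzd hfg,
    fun o => ⟨algebraMap O R o, by simp⟩⟩

/-- The `O`-algebra isomorphism `R ≃ₐ[O] O` produced by the depth squeeze. -/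
noncomputable def depthSqueezeEquiv {O R : Type*} [CommRing O] [CommRing R] [Algebra O R]
    (φ : R →ₐ[O] O) (y : R) (hy : y ∈ (⊥ : Ideal R).jacobson)
    (hgen : ∀ r : R, ∃ o : O, r - algebraMap O R o ∈ Ideal.span {y})
    (hdepth : ∃ a : O, algebraMap O R a ∈ Ideal.span {y} ∧ a ∣ φ y)
    (hnzd : φ y ∈ nonZeroDivisors O)
    (hfg : (RingHom.ker φ).FG) :
    R ≃ₐ[O] O :=
  AlgEquiv.ofBijective φ (depthSqueeze_bijective φ y hy hgen hdepth hnzd hfg)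

/-- **Local Noetherian form** (the shape used for a deformation ring `R_D`): if `R` is a local
Noetherian `O`-algebra, `y ∈ 𝔪_R`, `O ↠ R/(y)`, some `a : O` with `a·1 ∈ (y)` divides `φ y`, and
`φ y` is a non-zero-divisor of `O`, then the point `φ : R → O` is an isomorphism. -/
theorem depthSqueeze_bijective_of_isLocalRing {O R : Type*} [CommRing O] [CommRing R]
    [IsLocalRing R] [IsNoetherianRing R] [Algebra O R]
    (φ : R →ₐ[O] O) (y : R) (hy : y ∈ IsLocalRing.maximalIdeal R)
    (hgen : ∀ r : R, ∃ o : O, r - algebraMap O R o ∈ Ideal.span {y})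
    (hdepth : ∃ a : O, algebraMap O R a ∈ Ideal.span {y} ∧ a ∣ φ y)
    (hnzd : φ y ∈ nonZeroDivisors O) :
    Function.Bijective φ :=
  depthSqueeze_bijective φ y
    (by rwa [IsLocalRing.jacobson_eq_maximalIdeal ⊥ bot_ne_top]) hgen hdepth hnzd
    (IsNoetherian.noetherian (RingHom.ker φ))

end Summit.Langlands.Langlands.Theorems
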